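import Mathlib

/-!
# PneNP / ConvexRankGates — `ConvexGateBlind`: block matrices for the single-gate collapse

Helpers (`--supports stmt-PneNP-10680`) for the collapse of `{∧₂, ∨₂} ∪ CONV_s` circuits to ONE CONV
gate (`ConvexRankGatesConvexGateBlindCollapse.lean`), where the gates' semidefinite programmes are
packed block-diagonally into one PSD variable:
* `trace_single_mul`, `posSemidef_single_diag`: the elementary matrix `E_{aa}(c)`;
* `trace_blockDiagonal_mul`: `tr(blockDiagonal P · Y) = ∑ₖ tr(Pₖ · Y|ₖ)` for an ARBITRARY `Y`
  (`Y|ₖ` the `k`-th diagonal block), and its one- and two-key cases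
  `trace_blockDiagonal_ite_mul`, `trace_blockDiagonal_ite_ite_mul`;
* `posSemidef_blockDiagonal_of_forall`: a block-diagonal matrix with PSD blocks is PSD;
* `conv_feasible_pad`: a CONV programme with `p` rows and a `q × q` PSD variable is equivalent, on
  every input, to one with `P ≥ p` rows and a `Q × Q` variable (`Q ≥ q`, zero padding);
* `conv_feasible_reindex`: feasibility is invariant under re-indexing rows and the PSD variable.
-/

namespace Summit.PneNP.PneNP.Theorems

open Matrix Finset

section blocks

variable {m o : Type*}

/-- `tr(E_{aa}(c) · Y) = c · Y a a`. [folklore] -/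
theorem trace_single_mul [Fintype m] [DecidableEq m] (a : m) (c : ℝ) (Y : Matrix m m ℝ) :
    (Matrix.single a a c * Y).trace = c * Y a a := by
  rw [Matrix.trace]
  simp only [Matrix.diag_apply]
  rw [Finset.sum_eq_single a]
  · rw [Matrix.single_mul_apply_same]
  · intro b _ hb
    rw [Matrix.single_mul_apply_of_ne _ _ _ _ _ hb]
  · intro h
    exact absurd (Finset.mem_univ a) h

/-- `E_{aa}(c)` is positive semidefinite for `c ≥ 0`. [folklore] -/
theorem posSemidef_single_diag [DecidableEq m] (a : m) {c : ℝ} (hc : 0 ≤ c) :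
    (Matrix.single a a c).PosSemidef := by
  rw [← Matrix.diagonal_single]
  refine Matrix.PosSemidef.diagonal fun j => ?_
  by_cases h : j = a
  · subst h
    simpa using hc
  · simp [Pi.single_eq_of_ne h]

/-- The `k`-th diagonal block of a matrix indexed by `m × o`. [folklore] -/
theorem submatrix_blockDiagonal_prod [DecidableEq o] (P : o → Matrix m m ℝ) (k : o) :
    (blockDiagonal P).submatrix (fun a => (a, k)) (fun a => (a, k)) = P k := by
  ext a a'
  simp [blockDiagonal_apply_eq]

/-- `tr(blockDiagonal P · Y) = ∑ₖ tr(Pₖ · Y|ₖ)` for an arbitrary (not necessarily block-diagonal)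
`Y`, where `Y|ₖ` is the `k`-th diagonal block of `Y`. [folklore] -/
theorem trace_blockDiagonal_mul [Fintype m] [Fintype o] [DecidableEq o] (P : o → Matrix m m ℝ)
    (Y : Matrix (m × o) (m × o) ℝ) :
    (blockDiagonal P * Y).trace =
      ∑ k, (P k * Y.submatrix (fun a => (a, k)) (fun a => (a, k))).trace := by
  simp only [Matrix.trace, Matrix.diag_apply, Matrix.mul_apply, Matrix.submatrix_apply]
  rw [Fintype.sum_prod_type, Finset.sum_comm]
  refine Finset.sum_congr rfl fun k _ => Finset.sum_congr rfl fun a _ => ?_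
  rw [Fintype.sum_prod_type]
  refine Finset.sum_congr rfl fun a' _ => ?_
  rw [Finset.sum_eq_single k]
  · rw [blockDiagonal_apply_eq]
  · intro k' _ hk'
    rw [blockDiagonal_apply_ne _ _ _ (Ne.symm hk'), zero_mul]
  · intro h
    exact absurd (Finset.mem_univ k) h

/-- A block-diagonal real matrix whose blocks are positive semidefinite is positive semidefinite. [folklore] -/
theorem posSemidef_blockDiagonal_of_forall [Fintype m] [Fintype o] [DecidableEq o]
    {P : o → Matrix m m ℝ} (hP : ∀ k, (P k).PosSemidef) :
    (blockDiagonal P).PosSemidef := by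
  refine PosSemidef.of_dotProduct_mulVec_nonneg ?_ fun x => ?_
  · show (blockDiagonal P)ᴴ = blockDiagonal P
    rw [blockDiagonal_conjTranspose]
    congr 1
    funext k
    exact (hP k).isHermitian
  · have key : star x ⬝ᵥ (blockDiagonal P *ᵥ x) =
        ∑ k, star (fun a => x (a, k)) ⬝ᵥ (P k *ᵥ fun a => x (a, k)) := by
      simp only [dotProduct, mulVec, Fintype.sum_prod_type, Pi.star_apply]
      rw [Finset.sum_comm]
      refine Finset.sum_congr rfl fun k _ => Finset.sum_congr rfl fun a _ => ?_
      congr 1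
      refine Finset.sum_congr rfl fun a' _ => ?_
      rw [Finset.sum_eq_single k, blockDiagonal_apply_eq]
      · intro k' _ hk'
        rw [blockDiagonal_apply_ne _ _ _ (Ne.symm hk'), zero_mul]
      · intro h
        exact absurd (Finset.mem_univ k) h
    rw [key]
    exact Finset.sum_nonneg fun k _ => (hP k).dotProduct_mulVec_nonneg _

/-- One-key block constraint: `tr(blockDiagonal [k = k₁ ↦ M₁] · Y) = tr(M₁ · Y|_{k₁})`. [folklore] -/
theorem trace_blockDiagonal_ite_mul [Fintype m] [Fintype o] [DecidableEq o] (k₁ : o)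
    (M₁ : Matrix m m ℝ) (Y : Matrix (m × o) (m × o) ℝ) :
    (blockDiagonal (fun k => if k = k₁ then M₁ else 0) * Y).trace =
      (M₁ * Y.submatrix (fun a => (a, k₁)) (fun a => (a, k₁))).trace := by
  rw [trace_blockDiagonal_mul, Finset.sum_eq_single k₁]
  · rw [if_pos rfl]
  · intro k _ hk
    rw [if_neg hk, Matrix.zero_mul, Matrix.trace_zero]
  · intro h
    exact absurd (Finset.mem_univ k₁) h

/-- Two-key block constraint: for `k₁ ≠ k₂`,
`tr(blockDiagonal [k = k₁ ↦ M₁, k = k₂ ↦ M₂] · Y) = tr(M₁ · Y|_{k₁}) + tr(M₂ · Y|_{k₂})`. [folklore] -/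
theorem trace_blockDiagonal_ite_ite_mul [Fintype m] [Fintype o] [DecidableEq o] {k₁ k₂ : o}
    (h : k₁ ≠ k₂) (M₁ M₂ : Matrix m m ℝ) (Y : Matrix (m × o) (m × o) ℝ) :
    (blockDiagonal (fun k => if k = k₁ then M₁ else if k = k₂ then M₂ else 0) * Y).trace =
      (M₁ * Y.submatrix (fun a => (a, k₁)) (fun a => (a, k₁))).trace +
        (M₂ * Y.submatrix (fun a => (a, k₂)) (fun a => (a, k₂))).trace := by
  rw [trace_blockDiagonal_mul]
  have hsplit : ∀ k : o, ((if k = k₁ then M₁ else if k = k₂ then M₂ else 0) *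
      Y.submatrix (fun a => (a, k)) (fun a => (a, k))).trace =
      (if k = k₁ then (M₁ * Y.submatrix (fun a => (a, k₁)) (fun a => (a, k₁))).trace else 0) +
      (if k = k₂ then (M₂ * Y.submatrix (fun a => (a, k₂)) (fun a => (a, k₂))).trace else 0) := by
    intro k
    by_cases h1 : k = k₁
    · subst h1
      rw [if_pos rfl, if_pos rfl, if_neg h, add_zero]
    · rw [if_neg h1, if_neg h1, zero_add]
      by_cases h2 : k = k₂
      · subst h2
        rw [if_pos rfl, if_pos rfl]
      · rw [if_neg h2, if_neg h2, Matrix.zero_mul, Matrix.trace_zero]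
  simp_rw [hsplit]
  rw [Finset.sum_add_distrib, Finset.sum_ite_eq' Finset.univ k₁, Finset.sum_ite_eq' Finset.univ k₂,
    if_pos (Finset.mem_univ _), if_pos (Finset.mem_univ _)]

end blocks

/-! ### Zero padding of a CONV programme -/

section pad

/-- The coordinate-selection matrix of an injection `f : Fin q → Fin Q`: `S a j = [f a = j]`. Then
`S · Sᵀ = 1`. [folklore] -/
theorem select_mul_transpose_select {q Q : ℕ} (f : Fin q → Fin Q) (hf : Function.Injective f) :
    (Matrix.of fun (a : Fin q) (j : Fin Q) => if f a = j then (1 : ℝ) else 0) *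
      (Matrix.of fun (a : Fin q) (j : Fin Q) => if f a = j then (1 : ℝ) else 0)ᵀ = 1 := by
  ext a a'
  simp only [Matrix.mul_apply, Matrix.of_apply, Matrix.transpose_apply, mul_ite, mul_one, mul_zero]
  rw [Finset.sum_eq_single (f a)]
  · by_cases h : a = a'
    · subst h
      simp
    · rw [Matrix.one_apply_ne h, if_neg (fun h' => h (hf h'.symm))]
  · intro j _ hj
    rw [if_neg (Ne.symm hj)]
    split_ifs <;> rfl
  · intro h
    exact absurd (Finset.mem_univ _) h

/-- **Zero padding.** A CONV programme `∃ Y ⪰ 0 (q × q), ∀ i < p, tr(Aᵢ Y) ≤ rhsᵢ` is equivalent to a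
programme with `P ≥ p` rows and a `Q × Q` variable (`Q ≥ q`): embed `Y` as a principal block, pad the
`Aᵢ` by zeros, and add trivially true rows `0 ≤ 0`. The right-hand sides are carried along unchanged
(as a function `rhs`, later instantiated with `bᵢ + ∑ⱼ Bᵢⱼ [vⱼ]`). [folklore] -/
theorem conv_feasible_pad {p q P Q : ℕ} (hp : p ≤ P) (hq : q ≤ Q)
    (A : Fin p → Matrix (Fin q) (Fin q) ℝ) :
    ∃ A' : Fin P → Matrix (Fin Q) (Fin Q) ℝ, ∀ rhs : Fin p → ℝ,
      (∃ Y : Matrix (Fin q) (Fin q) ℝ, Y.PosSemidef ∧ ∀ i, (A i * Y).trace ≤ rhs i) ↔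
      (∃ Y' : Matrix (Fin Q) (Fin Q) ℝ, Y'.PosSemidef ∧
        ∀ i : Fin P, (A' i * Y').trace ≤ if h : i.val < p then rhs ⟨i, h⟩ else 0) := by
  classical
  set f : Fin q → Fin Q := Fin.castLE hq with hf
  have hfi : Function.Injective f := Fin.castLE_injective hq
  set S : Matrix (Fin q) (Fin Q) ℝ := Matrix.of fun a j => if f a = j then (1 : ℝ) else 0 with hS
  have hSS : S * Sᵀ = 1 := select_mul_transpose_select f hfi
  refine ⟨fun i => if h : i.val < p then Sᵀ * A ⟨i, h⟩ * S else 0, fun rhs => ⟨?_, ?_⟩⟩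
  · rintro ⟨Y, hY, hrows⟩
    refine ⟨Sᵀ * Y * S, ?_, fun i => ?_⟩
    · have := hY.conjTranspose_mul_mul_same S
      rwa [Matrix.conjTranspose_eq_transpose_of_trivial] at this
    · dsimp only
      by_cases h : i.val < p
      · rw [dif_pos h, dif_pos h]
        have : Sᵀ * A ⟨i, h⟩ * S * (Sᵀ * Y * S) = Sᵀ * (A ⟨i, h⟩ * Y) * S := by
          calc Sᵀ * A ⟨i, h⟩ * S * (Sᵀ * Y * S)
              = Sᵀ * A ⟨i, h⟩ * (S * Sᵀ) * Y * S := by simp only [Matrix.mul_assoc]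
            _ = Sᵀ * (A ⟨i, h⟩ * Y) * S := by rw [hSS, Matrix.mul_one]; simp only [Matrix.mul_assoc]
        rw [this, Matrix.trace_mul_cycle, hSS, Matrix.one_mul]
        exact hrows ⟨i, h⟩
      · rw [dif_neg h, dif_neg h, Matrix.zero_mul, Matrix.trace_zero]
  · rintro ⟨Y', hY', hrows⟩
    refine ⟨S * Y' * Sᵀ, ?_, fun i => ?_⟩
    · have := hY'.mul_mul_conjTranspose_same S
      rwa [Matrix.conjTranspose_eq_transpose_of_trivial] at this
    · have h : (Fin.castLE hp i).val < p := by simp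
      have hi := hrows (Fin.castLE hp i)
      dsimp only at hi
      rw [dif_pos h, dif_pos h] at hi
      have heq : (⟨(Fin.castLE hp i).val, h⟩ : Fin p) = i := Fin.ext (by simp)
      rw [heq] at hi
      calc (A i * (S * Y' * Sᵀ)).trace = (Sᵀ * A i * S * Y').trace := by
            rw [show A i * (S * Y' * Sᵀ) = A i * S * Y' * Sᵀ by simp only [Matrix.mul_assoc],
              Matrix.trace_mul_cycle, ← Matrix.mul_assoc]
        _ ≤ rhs i := hi

end pad

/-! ### Re-indexing rows and the PSD variable -/

/-- The trace is invariant under re-indexing along an equivalence. [folklore] -/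
theorem trace_submatrix_equiv_self {Q Q' : Type*} [Fintype Q] [Fintype Q'] (M : Matrix Q Q ℝ)
    (e : Q' ≃ Q) : (M.submatrix e e).trace = M.trace := by
  simp only [Matrix.trace, Matrix.diag_apply, Matrix.submatrix_apply]
  exact e.sum_comp (fun j => M j j)

/-- **Re-indexing.** Feasibility of a CONV programme does not depend on how its rows and its PSD
variable are indexed: transport along `Fintype.equivFin`. [folklore] -/
theorem conv_feasible_reindex {ι : Type*} [Fintype ι] {P Q : Type*} [Fintype P] [Fintype Q]
    [DecidableEq Q] (A : P → Matrix Q Q ℝ) (b : P → ℝ) (B : P → ι → ℝ) :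
    ∃ (A' : Fin (Fintype.card P) → Matrix (Fin (Fintype.card Q)) (Fin (Fintype.card Q)) ℝ)
      (b' : Fin (Fintype.card P) → ℝ) (B' : Fin (Fintype.card P) → ι → ℝ),
      (∀ i e, B' i e = B ((Fintype.equivFin P).symm i) e) ∧
      ∀ x : ι → Bool,
        (∃ Y : Matrix Q Q ℝ, Y.PosSemidef ∧
          ∀ l, (A l * Y).trace ≤ b l + ∑ e, B l e * (if x e then (1 : ℝ) else 0)) ↔
        (∃ Y' : Matrix (Fin (Fintype.card Q)) (Fin (Fintype.card Q)) ℝ, Y'.PosSemidef ∧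
          ∀ i, (A' i * Y').trace ≤ b' i + ∑ e, B' i e * (if x e then (1 : ℝ) else 0)) := by
  classical
  set eP := Fintype.equivFin P
  set eQ := Fintype.equivFin Q
  refine ⟨fun i => (A (eP.symm i)).submatrix eQ.symm eQ.symm, fun i => b (eP.symm i),
    fun i e => B (eP.symm i) e, fun _ _ => rfl, fun x => ⟨?_, ?_⟩⟩
  · rintro ⟨Y, hY, hrows⟩
    refine ⟨Y.submatrix eQ.symm eQ.symm, (Matrix.posSemidef_submatrix_equiv eQ.symm).2 hY,
      fun i => ?_⟩
    rw [Matrix.submatrix_mul_equiv, trace_submatrix_equiv_self]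
    exact hrows (eP.symm i)
  · rintro ⟨Y', hY', hrows⟩
    refine ⟨Y'.submatrix eQ eQ, (Matrix.posSemidef_submatrix_equiv eQ).2 hY', fun l => ?_⟩
    have hi := hrows (eP l)
    simp only [eP.symm_apply_apply] at hi
    have hY : (Y'.submatrix eQ eQ).submatrix eQ.symm eQ.symm = Y' := by
      rw [Matrix.submatrix_submatrix, eQ.self_comp_symm, Matrix.submatrix_id_id]
    rw [← hY, Matrix.submatrix_mul_equiv, trace_submatrix_equiv_self] at hi
    exact hi


end Summit.PneNP.PneNP.Theorems
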